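import Summits.QuantumFields.YangMills.Theses.InfiniteVolumeContinuum
import Summits.QuantumFields.YangMills.Theorems.InfiniteVolumeContinuumOSExistenceOfLegsOn
import Summits.QuantumFields.YangMills.Theorems.BalabanLadderROTClassDefs
import HarnessLib

/-!
# Route `InfiniteVolumeContinuum`: item `Assembly` (stmt-QuantumFields-19934, now an ASIDE) — re-proved after the
# leaf re-typing (planner g3 decision (iv), 2026-08-26)

Seat `ym-infvol-p1` (R136 (i)).  HONEST FRAMING: the statement is the pure implication
`UVCond → SeamRec → Rot → IVData → IVReflectionPositivity → IVEuclideanInvariance → OSExistenceFromInfiniteVolume`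
(the route's rev-0 assembly, banked as an aside at rev 1); nothing is asserted about its hypotheses — `UVCond`
(= Track A's `BalabanLadder.UV`), `SeamRec`, `Rot` are OPEN spine legs; existence half only, not a gap, not Clay.
Rev 0 proved it by currying the 6-binder `closes`; at rev 1 `closes` has 4 binders and a different conclusion, so the
composition is spelled out here (verbatim the rev-0 glue).  NOTE (R85, re-land 2026-08-27, planner g6
disposition): the rotation hypothesis is applied through the FROZEN named copy `Theorems.ROT.ROTRev1` (character-identical to
`BalabanLadder.ROT` rev 1–9, certificate `Theorems.ROT.rotRev1_iff_rot`), to which the route's aside alias `Rot` is re-pointed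
(route rev 7); the spine's R85 restate of `ROT` to the IR-guarded rev 2′ (needs `GapInUnits`, which this gap-free route cannot
supply — FINDING-20042 v3) therefore no longer touches this module.  Same statement, proof re-pointed in one token; the 4-leg E1
upgrade over rev 2′ stays `osExistenceIV_of_legs_rot2'`.
-/

set_option autoImplicit false

noncomputable section

namespace Summit.QuantumFields.YangMills.Theorems.InfiniteVolumeContinuum

/-- **`Assembly` holds** (rev-0 glue spelled out). [folklore] -/
theorem Assembly_proof : Summit.QuantumFields.YangMills.Theses.InfiniteVolumeContinuum.Assembly := by
  intro hUV hSeam hROT hD hRP hE1 G _ _ _ _ hG hcl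
  letI : MeasurableSpace G := borel G
  haveI : BorelSpace G := ⟨rfl⟩
  have hu : ∀ β : ℝ, 0 < Real.exp (Summit.QuantumFields.YangMills.Theorems.FemtoTransferGap.sizeLog β 1) :=
    fun β => Real.exp_pos _
  have hu0 := tendsto_exp_sizeLog_one_nhds_zero
  obtain ⟨r, hlb, hmb⟩ := (show Summit.QuantumFields.YangMills.Theses.BalabanLadder.UVSeamRec from hSeam)
    (show Summit.QuantumFields.YangMills.Theses.BalabanLadder.UV from hUV) G hG hcl
  have hrot := (show Summit.QuantumFields.YangMills.Theorems.ROT.ROTRev1 from hROT) G hG r _ hu hu0 hlb hmb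
  obtain ⟨β, μ, S₁, T, hdata, hN, hLG, hSym, hTr, hNT, hNG⟩ := hD G r _ hu hu0 hlb hmb
  have hrp := hRP G r _ β μ S₁ T hu hu0 hmb hdata
  have hE2 := Summit.QuantumFields.YangMills.Cruxes.OSLegsFromFemtoAndGap.DlrCollarTransfer.isReflectionPositive_of_rpPos hrp
  have hE0h := Summit.QuantumFields.YangMills.Theorems.OSLegsFromFemtoAndGap.isHermitian_of_isReflectionPositive S₁ hN hE2
  have hE1' := hE1 G r _ β μ S₁ T hu hu0 hmb hrot hdata hLG hTr hrp
  exact ⟨r, _, β, μ, S₁, T, hu, hu0, hdata, hN, hE0h, hLG, hE1', hE2, hSym, hTr, hNT, hNG⟩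

end Summit.QuantumFields.YangMills.Theorems.InfiniteVolumeContinuum

end
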